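import Summits.QuantumFields.YangMills.Theorems.F4SubCurvatureDoorFibreReductionKernel
import Summits.QuantumFields.YangMills.Theorems.F4SubCurvatureDoorFibreDichotomyTwoPointDomination
import Mathlib
import HarnessLib

/-!
# LINE g21-B «fibre dichotomy» (⟨stmt-QuantumFields-23125⟩) — B5 helper: almost every mass fibre of a shell-separated measure is
# LF-symmetric (`SymmetricLF`)

Helper toward the registered stub B5 `stub_fibreReduction` (`Cruxes/RationalToGeneral/Lines/fibre_dichotomy.lean` :176).  In the abstract
disintegration package (base `η`, fibres `ν_s`), suppose every measurable mass window `S` carries a Laplace–Fourier kernel of `μ|{massSq ∈ S}`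
invariant under EVERY `D₄`-isometry (this is what the shared stub S2 «shell separation» provides).  Then `η`-a.e. fibre `ν_s` is LF-symmetric:
`lfEval ν_s (R x) = lfEval ν_s x` for all `D₄`-isometries `R` and all `x` with `x₀ ≠ 0 ≠ (Rx)₀` (`ae_symmetricLF`).

The passage from «for each `(R, x)`, a.e. `s`» (✓ `ae_lfEval_invariant_at`) to «a.e. `s`, for all `(R, x)`» uses no finiteness of the
symmetry group: the admissible pairs, parametrised by `((R e_j)_j, x) ∈ (ℝ⁴)⁴ × ℝ⁴`, form a subset of a second-countable space, hence have a
countable dense subset; a.e. fibre is a shell measure, so `lfEval ν_s` is continuous off the mirror (✓ `analyticAt_lfEval`) and the identity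
extends from the dense subset by continuity.

Mathlib + tree only; no `sorry`; no new definitions.  HONEST LABEL: helper for a registered stub of an OPEN line; B5, S1, S2, ⟨23125⟩, ⟨23035⟩,
R2d and the Yang–Mills mass gap remain OPEN; no summit is proved by a line.
-/

noncomputable section

open MeasureTheory MeasureTheory.Measure Set Function Filter Topology ProbabilityTheory
open scoped BigOperators ENNReal

namespace Summit.QuantumFields.YangMills.Theorems.F4SubCurvatureDoorFibreReduction

open Summit.QuantumFields.YangMills.Theorems.F4SubCurvatureDoorLaplaceFourierRegistered (E4 E3 timeSpace IsLF)
open Summit.QuantumFields.YangMills.Theorems.F4SubCurvatureDoorFibreDichotomyAxis (spacePart lfEval IsD4Isometry SymmetricLF signIso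
  isD4Isometry_signIso)
open Summit.QuantumFields.YangMills.Theorems.F4SubCurvatureDoorShellLFAnalytic (massSq IsShellMeasure analyticAt_lfEval)

variable {μ : Measure (ℝ × E3)} {η : Measure ℝ} {ν : Kernel ℝ (ℝ × E3)}

/-! ## Linear isometries through their frame images -/

/-- A linear isometry is determined by its frame images: `R x = Σ_j x_j • R e_j`. -/
theorem iso_apply_eq_sum (R : E4 ≃ₗᵢ[ℝ] E4) (x : E4) :
    R x = ∑ j : Fin 4, x j • R (EuclideanSpace.single j (1 : ℝ)) := by
  have hx : x = ∑ j : Fin 4, x j • EuclideanSpace.single j (1 : ℝ) := by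
    ext i
    simp [Finset.sum_apply, Pi.single_apply, Finset.sum_ite_eq]
  conv_lhs => rw [hx]
  simp only [_root_.map_sum, LinearIsometryEquiv.map_smul]

/-! ## Almost every fibre is LF-symmetric -/

/-- **`η`-a.e. fibre is LF-symmetric.**  Hypotheses: the abstract disintegration package, Laplace integrability, and for every measurable
window a Laplace–Fourier kernel of the window measure invariant under all `D₄`-isometries. -/
theorem ae_symmetricLF [IsFiniteMeasure η] [IsSFiniteKernel ν]
    (hdis : ∀ S : Set ℝ, MeasurableSet S → ∀ f : ℝ × E3 → ℝ≥0∞, Measurable f →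
      ∫⁻ p in massSq ⁻¹' S, f p ∂μ = ∫⁻ s in S, ∫⁻ p, f p ∂(ν s) ∂η)
    (hfib : ∀ᵐ s ∂η, ν s {p | massSq p ≠ s} = 0) (hcone : ∀ᵐ s ∂η, ν s {p | p.1 < ‖p.2‖} = 0)
    (hint : ∀ t : ℝ, 0 < t → Integrable (fun p : ℝ × E3 => Real.exp (-(t * p.1))) μ)
    (hwin : ∀ S : Set ℝ, MeasurableSet S → ∃ KS : E4 → ℝ, IsLF KS (μ.restrict (massSq ⁻¹' S)) ∧
      ∀ R : E4 ≃ₗᵢ[ℝ] E4, IsD4Isometry R → ∀ x : E4, KS (R x) = KS x) :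
    ∀ᵐ s ∂η, SymmetricLF (ν s) := by
  -- admissible pairs `(frame images of R, x)`
  set act : (Fin 4 → E4) × E4 → E4 := fun q => ∑ j : Fin 4, q.2 j • q.1 j with hact
  have hact_c : Continuous act := by
    simp only [hact]
    fun_prop
  set G : Set ((Fin 4 → E4) × E4) := {q | (∃ R : E4 ≃ₗᵢ[ℝ] E4, IsD4Isometry R ∧ ∀ j, q.1 j = R (EuclideanSpace.single j (1 : ℝ))) ∧
    q.2 0 ≠ 0 ∧ (act q) 0 ≠ 0} with hG
  -- the action of `R` is `act` of its frame images
  have hactR : ∀ (R : E4 ≃ₗᵢ[ℝ] E4) (x : E4), act (fun j => R (EuclideanSpace.single j (1 : ℝ)), x) = R x := fun R x => by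
    simp only [hact]
    exact (iso_apply_eq_sum R x).symm
  -- a countable dense subset of the (second-countable) subtype `G`
  obtain ⟨D, hDc, hDd⟩ := TopologicalSpace.exists_countable_dense (↥G)
  -- for each admissible pair, a.e. fibre is invariant at that pair
  have hpair : ∀ g : ↥G, ∀ᵐ s ∂η, lfEval (ν s) (act g.1) = lfEval (ν s) g.1.2 := by
    intro g
    obtain ⟨⟨R, hR, hframe⟩, hx0, hRx0⟩ := g.2
    have hgR : act g.1 = R g.1.2 := by
      rw [← hactR R g.1.2]
      exact congrArg act (Prod.ext (funext fun j => hframe j) rfl)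
    rw [hgR] at hRx0 ⊢
    refine ae_lfEval_invariant_at hdis hfib hcone hint R (fun S hS => ?_) hx0 hRx0
    obtain ⟨KS, hLF, hinv⟩ := hwin S hS
    exact ⟨KS, hLF, fun x => hinv _ (isD4Isometry_signIso _) x, fun x => hinv R hR x⟩
  have hall : ∀ᵐ s ∂η, ∀ g ∈ D, lfEval (ν s) (act g.1) = lfEval (ν s) g.1.2 :=
    (ae_ball_iff hDc).2 fun g _ => hpair g
  filter_upwards [hall, ae_isShellMeasure hdis hfib hcone hint] with s hs hshell
  -- continuity off the mirror extends the identity from `D` to all of `G`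
  have hΨc : Continuous fun g : ↥G => lfEval (ν s) (act g.1) - lfEval (ν s) g.1.2 := by
    refine continuous_iff_continuousAt.2 fun g => ?_
    obtain ⟨-, hx0, hRx0⟩ := g.2
    have h1 : ContinuousAt (fun q : (Fin 4 → E4) × E4 => lfEval (ν s) (act q)) g.1 :=
      ((analyticAt_lfEval hshell hRx0).continuousAt).comp hact_c.continuousAt
    have h2 : ContinuousAt (fun q : (Fin 4 → E4) × E4 => lfEval (ν s) q.2) g.1 :=
      ((analyticAt_lfEval hshell hx0).continuousAt).comp continuous_snd.continuousAt
    exact ((h1.sub h2).comp continuous_subtype_val.continuousAt)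
  have hZ : IsClosed {g : ↥G | lfEval (ν s) (act g.1) - lfEval (ν s) g.1.2 = 0} := isClosed_eq hΨc continuous_const
  have hDZ : D ⊆ {g : ↥G | lfEval (ν s) (act g.1) - lfEval (ν s) g.1.2 = 0} := fun g hg => by
    simp only [mem_setOf_eq, hs g hg, sub_self]
  have huniv : ∀ g : ↥G, lfEval (ν s) (act g.1) - lfEval (ν s) g.1.2 = 0 := by
    intro g
    have : g ∈ closure D := by rw [hDd.closure_eq]; exact mem_univ _
    exact hZ.closure_subset_iff.2 hDZ this
  -- conclude
  intro R hR x hx hRx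
  have hmem : ((fun j => R (EuclideanSpace.single j (1 : ℝ))), x) ∈ G :=
    ⟨⟨R, hR, fun j => rfl⟩, hx, by rw [hactR]; exact hRx⟩
  have h := huniv ⟨_, hmem⟩
  rw [sub_eq_zero] at h
  simpa [hactR] using h

end Summit.QuantumFields.YangMills.Theorems.F4SubCurvatureDoorFibreReduction

end
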